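import Summits.NavierStokesRegularity.NavierStokesRegularity.Theorems.CalmSliceGateOneCalmSlice
import Summits.NavierStokesRegularity.NavierStokesRegularity.Theorems.LerayQuarterDissipationRecurrentReductionD
import HarnessLib

/-!
# Route `CalmSliceGate`, deciding crux `PerpetualFlickerLiouville` (stmt-NavierStokesRegularity-24374):
# LINKS — the flicker crux IS `FiniteDissipationLiouville`, and its recurrent reduction is free

Theorems file (seat ns-lqd-p2 g7, cell ns-idea-3; `--supports` item 24374). Navier–Stokes regularity
is NOT proved by anything here; `PerpetualFlickerLiouville` and `FiniteDissipationLiouville` both stay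
OPEN — this file only relates them.

With the converter K1 PROVED (`oneCalmSlice_proof`, p595719: for all `C, K` there are `δ, R > 0`
such that a member of `𝒟_{C,K}` with one `(δ,R)`-calm slice is regular at the apex), every
SINGULAR member of `𝒟_{C,K}` flickers perpetually with the K1 floor `(δ(C,K), R(C,K))`. Hence:

* `finiteDissipationLiouville_iff_perpetualFlickerLiouville` — the deciding crux of `CalmSliceGate`
  is EQUIVALENT to LQD's `FiniteDissipationLiouville` (the critic's kernel identity
  "K2 ⟺ FDL modulo K1", now a theorem since K1 is);
* `perpetualFlickerLiouville_of_recurrentFlickerLiouville` — **the registered reduction stub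
  `stub_flickerRecurrentReduction` of the 24374 skeleton is DISPENSABLE**: the flicker Liouville
  theorem for UNIFORMLY RECURRENT members (the shape of the other registered stub
  `stub_recurrentFlickerLiouville`, universally closed over `C K δ R`) already implies
  `PerpetualFlickerLiouville` — by LQD's proved recurrent reduction (`recurrentReductionD_proof`,
  item 22507: a singular member of some stratum yields a uniformly recurrent singular member of some
  stratum `𝒟_{C',K'}`) followed by K1 at `(C', K')`, which supplies the flicker floor of the
  recurrent element. No convergence of time derivatives along KNSS limits (the analytic input the
  registered reduction stub would need, absent from the tree) is required;
* `finiteDissipationLiouville_of_recurrentFlickerLiouville` — the same hypothesis closes LQD's crux.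

So the honest residue of the line is ONE statement: flicker Liouville for uniformly recurrent
members of the stratum (at the K1 constants) — the wall, as labelled.
-/

noncomputable section

-- the summit and its single sub-problem share the name (CONVENTIONS §1), as in every Theorems file
set_option linter.dupNamespace false

namespace Summit.NavierStokesRegularity.NavierStokesRegularity.Theorems.PerpetualFlickerLiouville.Links

open MeasureTheory Set Filter Topology Metric Function
open Literature.Analysis Literature.Analysis.FluidPDE
open Summit.NavierStokesRegularity.NavierStokesRegularity.Theorems
open scoped ENNReal NNReal

/-- **Every singular member of `𝒟_{C,K}` flickers perpetually** with the K1 floor: there are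
`δ(C,K), R(C,K) > 0` such that a member singular at the apex has, at EVERY `t < 0`, a point
`x ∈ B(0, R√(−t))` with scale-critical unsteadiness `> δ` (contrapositive of `oneCalmSlice_proof`). [cite: Tsai1998, Theorem 1 (p. 31)] -/
theorem flicker_of_singular (C K : ℝ) : ∃ δ > 0, ∃ R > 0,
    ∀ (w : ℝ → EuclideanSpace ℝ (Fin 3) → EuclideanSpace ℝ (Fin 3)),
      IsTypeIAncientMild C w →
      (∀ s : ℝ, s < 0 → ∫⁻ x, ‖fderiv ℝ (w s) x‖ₑ ^ 2 ≤ ENNReal.ofReal (K / Real.sqrt (-s))) →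
      (∀ r > 0, ∀ M : ℝ, ∃ t ∈ Ioo (-(r ^ 2)) (0 : ℝ),
        ∃ x ∈ ball (0 : EuclideanSpace ℝ (Fin 3)) r, M < ‖w t x‖) →
      ∀ t < 0, ∃ x ∈ ball (0 : EuclideanSpace ℝ (Fin 3)) (R * Real.sqrt (-t)),
        δ < ‖Real.sqrt (-t) • ((-t) • deriv (fun τ => w τ x) t - (1 / 2 : ℝ) • w t x -
          (1 / 2 : ℝ) • fderiv ℝ (w t) x x)‖ := by
  obtain ⟨δ, hδ, R, hR, hK1⟩ := oneCalmSlice_proof C K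
  refine ⟨δ, hδ, R, hR, fun w hw hlaw hsing t ht => ?_⟩
  by_contra hcalm
  push Not at hcalm
  exact hK1 w hw hlaw ⟨t, ht, hcalm⟩ hsing

/-- **`PerpetualFlickerLiouville ⟺ FiniteDissipationLiouville`** (the deciding crux of
`CalmSliceGate` is LQD's crux: forward, a flickering member is in particular a member; backward,
every singular member flickers by K1). -/
theorem finiteDissipationLiouville_iff_perpetualFlickerLiouville :
    Summit.NavierStokesRegularity.NavierStokesRegularity.Theses.LerayQuarterDissipation.FiniteDissipationLiouville ↔
      Summit.NavierStokesRegularity.NavierStokesRegularity.Theses.CalmSliceGate.PerpetualFlickerLiouville := by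
  unfold Summit.NavierStokesRegularity.NavierStokesRegularity.Theses.LerayQuarterDissipation.FiniteDissipationLiouville
    Summit.NavierStokesRegularity.NavierStokesRegularity.Theses.CalmSliceGate.PerpetualFlickerLiouville
  constructor
  · intro h C K δ R _ _ w hw hlaw _
    exact h C K w hw hlaw
  · intro h C K w hw hlaw hsing
    obtain ⟨δ, hδ, R, hR, hfl⟩ := flicker_of_singular C K
    exact h C K δ R hδ hR w hw hlaw (hfl w hw hlaw hsing) hsing

/-- **The recurrent flicker Liouville theorem implies `PerpetualFlickerLiouville`** — the
reduction to uniformly recurrent members is FREE (no new analysis): a flickering singular member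
of `𝒟_{C,K}` gives, by LQD's recurrent reduction (`recurrentReductionD_proof`), a uniformly
recurrent singular member of some `𝒟_{C',K'}`, which flickers with the K1 floor of `(C', K')`
(`flicker_of_singular`) and is therefore excluded by the hypothesis at `(C', K', δ(C',K'), R(C',K'))`.
The hypothesis is the universally closed signature of the registered stub
`stub_recurrentFlickerLiouville` of the 24374 skeleton. [cite: KochNadirashviliSereginSverak2009, §4 (arXiv:0709.3599 p. 8)] -/
theorem perpetualFlickerLiouville_of_recurrentFlickerLiouville
    (h : ∀ (C K δ R : ℝ), 0 < δ → 0 < R →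
      ∀ (w : ℝ → EuclideanSpace ℝ (Fin 3) → EuclideanSpace ℝ (Fin 3)),
        IsTypeIAncientMild C w →
        (∀ s : ℝ, s < 0 → ∫⁻ x, ‖fderiv ℝ (w s) x‖ₑ ^ 2 ≤ ENNReal.ofReal (K / Real.sqrt (-s))) →
        (∀ ε > 0, ∀ R' > 1, ∃ L > 0, ∀ a : ℝ, ∃ σ ∈ Set.Icc a (a + L),
          ∀ s ∈ Set.Icc (-(R' ^ 2)) (-(R'⁻¹) ^ 2),
            ∀ y ∈ Metric.closedBall (0 : EuclideanSpace ℝ (Fin 3)) R',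
              ‖Real.exp σ • w (Real.exp (2 * σ) * s) (Real.exp σ • y) - w s y‖ ≤ ε) →
        (∀ t < 0, ∃ x ∈ Metric.ball (0 : EuclideanSpace ℝ (Fin 3)) (R * Real.sqrt (-t)),
          δ < ‖Real.sqrt (-t) • ((-t) • deriv (fun τ => w τ x) t - (1 / 2 : ℝ) • w t x -
            (1 / 2 : ℝ) • fderiv ℝ (w t) x x)‖) →
        ¬ (∀ r > 0, ∀ M : ℝ, ∃ t ∈ Set.Ioo (-(r ^ 2)) (0 : ℝ),
          ∃ x ∈ Metric.ball (0 : EuclideanSpace ℝ (Fin 3)) r, M < ‖w t x‖)) :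
    Summit.NavierStokesRegularity.NavierStokesRegularity.Theses.CalmSliceGate.PerpetualFlickerLiouville := by
  unfold Summit.NavierStokesRegularity.NavierStokesRegularity.Theses.CalmSliceGate.PerpetualFlickerLiouville
  intro C K δ R _ _ w hw hlaw _ hsing
  -- recurrent reduction: a uniformly recurrent singular member of some stratum
  have hred := recurrentReductionD_proof
  unfold Summit.NavierStokesRegularity.NavierStokesRegularity.Theses.LerayQuarterDissipation.RecurrentReductionD
    at hred
  obtain ⟨C', K', w', hw', hlaw', hrec', hsing'⟩ := hred C K w hw hlaw hsing
  -- K1 at `(C', K')`: the recurrent element flickers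
  obtain ⟨δ₁, hδ₁, R₁, hR₁, hfl⟩ := flicker_of_singular C' K'
  exact h C' K' δ₁ R₁ hδ₁ hR₁ w' hw' hlaw' hrec' (hfl w' hw' hlaw' hsing') hsing'

/-- **The recurrent flicker Liouville theorem closes LQD's crux as well**
(`perpetualFlickerLiouville_of_recurrentFlickerLiouville` +
`finiteDissipationLiouville_iff_perpetualFlickerLiouville`). -/
theorem finiteDissipationLiouville_of_recurrentFlickerLiouville
    (h : ∀ (C K δ R : ℝ), 0 < δ → 0 < R →
      ∀ (w : ℝ → EuclideanSpace ℝ (Fin 3) → EuclideanSpace ℝ (Fin 3)),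
        IsTypeIAncientMild C w →
        (∀ s : ℝ, s < 0 → ∫⁻ x, ‖fderiv ℝ (w s) x‖ₑ ^ 2 ≤ ENNReal.ofReal (K / Real.sqrt (-s))) →
        (∀ ε > 0, ∀ R' > 1, ∃ L > 0, ∀ a : ℝ, ∃ σ ∈ Set.Icc a (a + L),
          ∀ s ∈ Set.Icc (-(R' ^ 2)) (-(R'⁻¹) ^ 2),
            ∀ y ∈ Metric.closedBall (0 : EuclideanSpace ℝ (Fin 3)) R',
              ‖Real.exp σ • w (Real.exp (2 * σ) * s) (Real.exp σ • y) - w s y‖ ≤ ε) →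
        (∀ t < 0, ∃ x ∈ Metric.ball (0 : EuclideanSpace ℝ (Fin 3)) (R * Real.sqrt (-t)),
          δ < ‖Real.sqrt (-t) • ((-t) • deriv (fun τ => w τ x) t - (1 / 2 : ℝ) • w t x -
            (1 / 2 : ℝ) • fderiv ℝ (w t) x x)‖) →
        ¬ (∀ r > 0, ∀ M : ℝ, ∃ t ∈ Set.Ioo (-(r ^ 2)) (0 : ℝ),
          ∃ x ∈ Metric.ball (0 : EuclideanSpace ℝ (Fin 3)) r, M < ‖w t x‖)) :
    Summit.NavierStokesRegularity.NavierStokesRegularity.Theses.LerayQuarterDissipation.FiniteDissipationLiouville :=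
  finiteDissipationLiouville_iff_perpetualFlickerLiouville.2
    (perpetualFlickerLiouville_of_recurrentFlickerLiouville h)

end Summit.NavierStokesRegularity.NavierStokesRegularity.Theorems.PerpetualFlickerLiouville.Links

end
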